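import Summits.BirchSwinnertonDyer.Rank1Residual.X11a.SelmerCompanionTwistedNorm
import Summits.BirchSwinnertonDyer.Rank1Residual.X11a.SelmerCompanionNonsplit
import Literature.NumberTheory.EllipticCurves.GeomPointsGaloisModule
import HarnessLib

/-!
# Route (3e) SELMER COMPANION, XI-a: Milne I.3.8 at a NON-SPLIT multiplicative place `v ∤ p` for
# `p`-torsion crossed homomorphisms (class X11a = N7; cell `b2b-bsdres`, unit `b2b-bsdres-x11a`,
# gen 28)

HONEST FRAMING (run/shared/lean/b2b/bsd-rank1-residual/, verbatim in every file): the goal of the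
cell is to DELETE the COMBINATION-SHAPED residual classes of the Birch–Swinnerton-Dyer formula for
ALL analytic-rank `≤ 1` elliptic curves over `ℚ` — "full BSD formula for every rank `≤ 1` curve in
class `C`" assembled STRICTLY from published theorems — so that the rank-`≤ 1` remainder becomes
exactly the CONSTRUCTION-SHAPED classes, which are TYPED (missing-input `Prop`s), NOT attempted.
This is not "finishing BSD". CLASS-OWNERS.md: research routes; NO CLAIM BEYOND STATED CLASSES.
THEOREMS ONLY; nothing booked; no label moves. CONDITIONAL on the PUBLISHED named fact
`Silverman1994_thmV53_corV54_tateUniformisation` (twisted Tate uniformisation, `hU`).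

## The lemma (`exists_eq_smul_sub_of_nonsplit`)

Let `E = W` be an elliptic curve over a number field `K`, `p` an odd prime, `v ∤ p` a finite place
at which `E` has NON-SPLIT multiplicative reduction (`γ(E) = −c₄/c₆` not a square in `K_v`) and
whose inertia group fixes `√γ` (automatic over `ℚ` at odd `ℓ`, tree
`X2.GreenbergVatsalTateDatumRat.inertia_fix_sqrt_gamma`). Then **every crossed homomorphism
`g : Γ_{K_v} → E(K̄_v)` killed by `p`, whose zero set is a neighbourhood of `1`, vanishing on the
inertia group `I_𝔐`, is principal**: `g(σ) = σb − b`. (For GOOD reduction this is Milne, *ADT*,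
I Prop. 3.8, tree `Milne2006_unramifiedClass_eq_zero_holds`; for non-split multiplicative reduction
and `p` odd it is the statement `H¹(K_v^nr/K_v, E(K_v^nr))[p] = H¹(k_v, Φ_v)[p] = 0`, the group of
`k_v`-rational components of a non-split node having order `≤ 2` — Silverman, *ATAEC*, IV
Cor. 9.2 (d), V Ex. 5.11.)

Proof, through the twisted Tate parametrisation `Ψ : K̄_v^× → E(K̄_v)`, `ker Ψ = Q^ℤ`,
`σΨ(u) = ε(σ)Ψ(σu)`, `ε(σ) = σ(√γ)/√γ` [Silverman V.5.2 (c), 5.3, 5.4, the named fact `hU`]: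
take an arithmetic Frobenius `F`; it MOVES `√γ` (`apply_ne_of_forall_ne_sq_of_inertia`, file X:
the stabiliser of `√γ` is open and would otherwise contain `F` and `I`, i.e. everything), so
`ε(F) = −1`, `ε|_I = 1`. The value `m = g(F)` is fixed by `I` (cocycle identity, `I` normal,
`g|_I = 0`); writing `m = Ψ(μ)` one gets `μ^p ∈ Q^ℤ` (`pm = 0`) and `μ` fixed by `I` (a `p`-th root
of unity in `Q^ℤ` is `1`, as `|Q|_v < 1`). The twisted norm equation of file X gives `β` fixed by
`I` with `β·F(β)·μ = Q^s`; then `b = Ψ(β)` is fixed by `I` and `Fb − b = −Ψ(F β) − Ψ(β) =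
Ψ((β F β)^{-1}) = Ψ(μ Q^{-s}) = m`. Finally `U = {σ : g(σ) = σb − b}` is a subgroup (cocycle
identity), open (it contains the open set `{g = 0} ∩ Stab(b)` around `1`), and contains `F` and
`I`, hence is `Γ_{K_v}` (`eq_top_of_isOpen_of_frobenius_mem_of_inertia_le`, Neukirch II §9).
Consumer: `X11a/SelmerCompanionNonsplitPartner.lean` (kind (vi) of the route-(3e) count).

References: [SilvermanATAEC1994] Ch. IV Cor. 9.2 (d), Ch. V Lemma 5.2 (c), Thm. 5.3, Cor. 5.4,
Ex. 5.11; [MilneADT2006] I Prop. 3.8; [NeukirchANT1999] II §9 (9.9)–(9.11);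
HOME/b2b-bsdres-x11a/REPORT-g28.md.
-/

set_option autoImplicit false

noncomputable section

open scoped Classical NNReal Topology

open WeierstrassCurve Literature.NumberTheory.EllipticCurves
  Literature.NumberTheory.GaloisRepresentations Field NumberField IsDedekindDomain
  IsDedekindDomain.HeightOneSpectrum

namespace Summit.BirchSwinnertonDyer.Rank1Residual.X11a.SelmerCompanion

variable {K : Type} [Field K] [NumberField K] (W : WeierstrassCurve K) [W.IsElliptic]
  {p : ℕ} [hp : Fact p.Prime] (v : HeightOneSpectrum (𝓞 K))

/-- **Milne I.3.8 at a NON-SPLIT multiplicative place, `p`-torsion case.** Let `E = W` be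
multiplicative at `v` with `γ(E)` not a square in `K_v` and inertia fixing `√γ`, `p` an odd prime
with `v ∤ p`. Every crossed homomorphism `g : Γ_{K_v} → E(K̄_v)` (`g(στ) = g(σ) + σg(τ)`) whose zero
set is a neighbourhood of `1`, which is killed by `p` and vanishes on the inertia group `I_𝔐`, is
principal: `∃ b, ∀ σ, g(σ) = σb − b`. Proof in the module docstring (twisted Tate parametrisation,
a Frobenius moving `√γ`, the twisted norm equation of file X, and generation of `Γ_{K_v}` by `F` and
`I_𝔐` modulo open subgroups). CONDITIONAL on the named fact `hU`.
[cite: SilvermanATAEC1994, Ch. V Lemma 5.2 (c), Thm. 5.3, Cor. 5.4, Ex. 5.11]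
[cite: MilneADT2006, Ch. I Prop. 3.8] [cite: NeukirchANT1999, Ch. II §9 Prop. (9.9)–(9.11)] -/
theorem exists_eq_smul_sub_of_nonsplit
    (hU : Silverman1994_thmV53_corV54_tateUniformisation.{0}) (hp2 : p ≠ 2)
    (hW : W.HasMultiplicativeReductionAt v)
    (hγ : ∀ r : v.adicCompletion K, algebraMap K (v.adicCompletion K) (-(W.c₄ / W.c₆)) ≠ r ^ 2)
    (hpv : (p : 𝓞 K) ∉ v.asIdeal)
    {𝔐 : Ideal v.localAbsIntegers} (h𝔐 : 𝔐 ∈ v.localPrimesAbove)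
    (ht : ∀ t : AlgebraicClosure (v.adicCompletion K),
      t ^ 2 = algebraMap (v.adicCompletion K) (AlgebraicClosure (v.adicCompletion K))
        (algebraMap K (v.adicCompletion K) (-(W.c₄ / W.c₆))) →
      ∀ σ ∈ 𝔐.inertia (absoluteGaloisGroup (v.adicCompletion K)),
        Field.absoluteGaloisGroup.toAlgEquiv (v.adicCompletion K) σ t = t)
    {g : absoluteGaloisGroup (v.adicCompletion K) → localPoints W (v.adicCompletion K)}
    (hg : ∀ σ τ, g (σ * τ) = g σ + σ • g τ)
    (hg1 : {σ | g σ = 0} ∈ 𝓝 (1 : absoluteGaloisGroup (v.adicCompletion K)))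
    (hgp : ∀ σ, (p : ℤ) • g σ = 0)
    (hgI : ∀ σ ∈ 𝔐.inertia (absoluteGaloisGroup (v.adicCompletion K)), g σ = 0) :
    ∃ b : localPoints W (v.adicCompletion K), ∀ σ, g σ = σ • b - b := by
  have hpp : p.Prime := hp.out
  haveI : NeZero p := ⟨hpp.ne_zero⟩
  haveI : CharZero (v.adicCompletion K) := charZero_adicCompletion v
  haveI := v.inertia_normal_of_mem_localPrimesAbove h𝔐
  obtain ⟨w, hw⟩ := v.exists_spectralValuation
  -- cocycle algebra
  have hg_one : g 1 = 0 := by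
    have h := hg 1 1
    rw [mul_one, one_smul, left_eq_add] at h
    exact h
  have hg_inv : ∀ σ, g σ⁻¹ = -(σ⁻¹ • g σ) := by
    intro σ
    have h := hg σ⁻¹ σ
    rw [inv_mul_cancel, hg_one] at h
    exact eq_neg_of_add_eq_zero_left h.symm
  -- twisted Tate parametrisation of `E` at `v`
  obtain ⟨q, t, Φ, hq0, hq1, -, ht2, hsurj, hker, hequiv₀, -⟩ := hU W v hW
  -- an arithmetic Frobenius `F`; it moves `t = √γ`
  obtain ⟨F, hF⟩ := v.exists_isArithFrobAt_localAbsIntegers h𝔐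
  have hFt : Field.absoluteGaloisGroup.toAlgEquiv (v.adicCompletion K) F t ≠ t :=
    apply_ne_of_forall_ne_sq_of_inertia h𝔐 hF hγ ht2 (ht t ht2)
  -- the sign `ε(σ) = χ(σ)`: `−1` at `F`, `1` on `I`
  obtain ⟨ε, hε_of_fix, hε_of_not⟩ : ∃ ε : (absoluteGaloisGroup (v.adicCompletion K)) → ℤ,
      (∀ σ, Field.absoluteGaloisGroup.toAlgEquiv (v.adicCompletion K) σ t = t → ε σ = 1) ∧
        (∀ σ, Field.absoluteGaloisGroup.toAlgEquiv (v.adicCompletion K) σ t ≠ t → ε σ = -1) :=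
    ⟨fun σ ↦ if Field.absoluteGaloisGroup.toAlgEquiv (v.adicCompletion K) σ t = t then 1 else -1,
      fun σ h ↦ if_pos h, fun σ h ↦ if_neg h⟩
  have hequiv : ∀ (σ : (absoluteGaloisGroup (v.adicCompletion K))) (u : (AlgebraicClosure
      (v.adicCompletion K))ˣ),
      σ • Φ (Additive.ofMul u) = Φ (Additive.ofMul ((Units.map
          (absoluteGaloisGroup.toAlgEquiv _ σ : AlgebraicClosure (v.adicCompletion K)
          →* AlgebraicClosure (v.adicCompletion K)) u) ^ (ε σ))) := by
    intro σ u
    rw [hequiv₀ σ u, ofMul_zpow, map_zsmul]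
    by_cases h : Field.absoluteGaloisGroup.toAlgEquiv (v.adicCompletion K) σ t = t
    · rw [if_pos h, hε_of_fix σ h]
    · rw [if_neg h, hε_of_not σ h]
  have hεF : ε F = -1 := hε_of_not F hFt
  have hεI : ∀ τ ∈ 𝔐.inertia (absoluteGaloisGroup (v.adicCompletion K)), ε τ = 1 :=
    fun τ hτ ↦ hε_of_fix τ (ht t ht2 τ hτ)
  -- the Tate period as a unit `Q` of `K̄_v`: fixed by `Γ`, `|Q|_v < 1`, `Φ(Q^ℤ) = 0`
  have hQe0 : algebraMap (v.adicCompletion K) (AlgebraicClosure (v.adicCompletion K)) q ≠ 0 :=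
    (map_ne_zero _).mpr hq0
  set Q : (AlgebraicClosure (v.adicCompletion K))ˣ := Units.mk0 _ hQe0 with hQ
  have hQσ : ∀ σ : absoluteGaloisGroup (v.adicCompletion K),
      σ • (Q : AlgebraicClosure (v.adicCompletion K)) = Q := fun σ ↦ by
    rw [hQ, Units.val_mk0, absoluteGaloisGroup.smul_def, AlgEquiv.commutes]
  have hQσ' : ∀ σ : absoluteGaloisGroup (v.adicCompletion K), Units.map
      (absoluteGaloisGroup.toAlgEquiv _ σ : AlgebraicClosure (v.adicCompletion K)
        →* AlgebraicClosure (v.adicCompletion K)) Q = Q :=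
    fun σ ↦ Units.ext (hQσ σ)
  have hwQ : w (Q : AlgebraicClosure (v.adicCompletion K)) < 1 := by
    rw [hQ, Units.val_mk0, ← NNReal.coe_lt_coe, coe_spectralValuation_algebraMap hw, NNReal.coe_one,
      Valued.toNormedField.norm_lt_one_iff]
    exact hq1
  have hΦQ : ∀ k : ℤ, Φ (Additive.ofMul (Q ^ k)) = 0 := fun k ↦
    (hker _).mpr ⟨k, by rw [Units.val_zpow_eq_zpow_val, hQ, Units.val_mk0]⟩
  -- `m = g(F)` is fixed by the inertia group
  have hmI : ∀ τ ∈ 𝔐.inertia (absoluteGaloisGroup (v.adicCompletion K)), τ • g F = g F := by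
    intro τ hτ
    have hτ' : F⁻¹ * τ * F ∈ 𝔐.inertia (absoluteGaloisGroup (v.adicCompletion K)) := by
      have h := Subgroup.Normal.conj_mem inferInstance τ hτ F⁻¹
      rwa [inv_inv] at h
    have h1 : g (τ * F) = τ • g F := by rw [hg, hgI τ hτ, zero_add]
    have h2 : g (F * (F⁻¹ * τ * F)) = g F := by rw [hg, hgI _ hτ', smul_zero, add_zero]
    have h3 : τ * F = F * (F⁻¹ * τ * F) := by group
    rw [← h1, h3, h2]
  -- `m = Φ(μ)` with `μ^p ∈ Q^ℤ`
  obtain ⟨x, hx⟩ := hsurj (g F)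
  set μ : (AlgebraicClosure (v.adicCompletion K))ˣ := Additive.toMul x with hμ
  have hxμ : Φ (Additive.ofMul μ) = g F := by rw [hμ]; exact hx
  have hμp : ∃ n : ℤ, μ ^ p = Q ^ n := by
    have h0 : Φ (Additive.ofMul (μ ^ p)) = 0 := by
      rw [ofMul_pow, map_nsmul, hxμ, ← natCast_zsmul, hgp]
    obtain ⟨n, hn⟩ := (hker _).mp h0
    refine ⟨n, Units.ext ?_⟩
    rw [hn, Units.val_zpow_eq_zpow_val, hQ, Units.val_mk0]
  -- `μ` is fixed by the inertia group
  have hμI : ∀ τ ∈ 𝔐.inertia (absoluteGaloisGroup (v.adicCompletion K)),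
      τ • (μ : AlgebraicClosure (v.adicCompletion K)) = μ := by
    intro τ hτ
    set η : (AlgebraicClosure (v.adicCompletion K))ˣ := Units.map
      (absoluteGaloisGroup.toAlgEquiv _ τ : AlgebraicClosure (v.adicCompletion K)
        →* AlgebraicClosure (v.adicCompletion K)) μ * μ⁻¹ with hη
    -- `Φ(η) = 0`, so `η ∈ Q^ℤ`
    have h1 : Φ (Additive.ofMul (Units.map
        (absoluteGaloisGroup.toAlgEquiv _ τ : AlgebraicClosure (v.adicCompletion K)
          →* AlgebraicClosure (v.adicCompletion K)) μ)) = Φ (Additive.ofMul μ) := by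
      have h := hequiv τ μ
      rw [hεI τ hτ, zpow_one] at h
      rw [← h, hxμ]
      exact hmI τ hτ
    have h2 : Φ (Additive.ofMul η) = 0 := by
      rw [hη, ofMul_mul, ofMul_inv, map_add, map_neg, h1, add_neg_cancel]
    obtain ⟨k, hk⟩ := (hker _).mp h2
    -- `η^p = 1` (`τ` fixes `μ^p = Q^n`)
    obtain ⟨n, hn⟩ := hμp
    have hηp : η ^ p = 1 := by
      rw [hη, mul_pow, ← map_pow, inv_pow, hn, map_zpow, hQσ' τ, mul_inv_cancel]
    -- hence `|Q|^{kp} = 1` and `k = 0`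
    have hk0 : k = 0 := by
      have hQval : (Q : AlgebraicClosure (v.adicCompletion K)) =
          algebraMap (v.adicCompletion K) (AlgebraicClosure (v.adicCompletion K)) q := by
        rw [hQ, Units.val_mk0]
      have h3 : (w (Q : AlgebraicClosure (v.adicCompletion K)) ^ k) ^ p = 1 := by
        rw [← map_zpow₀, hQval, ← hk, ← map_pow, ← Units.val_pow_eq_pow_val, hηp, Units.val_one,
          map_one]
      have h4 : w (Q : AlgebraicClosure (v.adicCompletion K)) ^ k = 1 :=
        (pow_eq_one_iff_of_nonneg zero_le hpp.ne_zero).mp h3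
      have hQpos : 0 < w (Q : AlgebraicClosure (v.adicCompletion K)) :=
        (Valuation.pos_iff w).mpr (Units.ne_zero Q)
      exact zpow_right_injective₀ hQpos hwQ.ne (h4.trans (zpow_zero _).symm)
    have hη1 : η = 1 := Units.ext (by rw [hk, hk0, zpow_zero, Units.val_one])
    have h5 : Units.map (absoluteGaloisGroup.toAlgEquiv _ τ : AlgebraicClosure (v.adicCompletion K)
        →* AlgebraicClosure (v.adicCompletion K)) μ = μ := by
      rw [← mul_inv_eq_one, ← hη, hη1]
    exact congrArg Units.val h5
  -- the twisted norm equation: `β` fixed by `I` with `β F(β) μ = Q^s`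
  have hwp : w (p : AlgebraicClosure (v.adicCompletion K)) = 1 := by
    have h := spectralValuation_intCast_eq_one hw (n := (p : ℤ)) (by rwa [Int.cast_natCast])
    rwa [Int.cast_natCast] at h
  obtain ⟨β, hβI, s, hβ⟩ :=
    exists_units_mul_frobenius_mul_eq_zpow hw h𝔐 hF hpp hp2 hwp hQσ hμp hμI
  -- `b = Φ(β)`: fixed by `I`, and `F b − b = m`
  set b : localPoints W (v.adicCompletion K) := Φ (Additive.ofMul β) with hb
  have hbI : ∀ τ ∈ 𝔐.inertia (absoluteGaloisGroup (v.adicCompletion K)), τ • b = b := by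
    intro τ hτ
    rw [hb, hequiv τ β, hεI τ hτ, zpow_one]
    congr 2
    exact Units.ext (hβI τ hτ)
  have hbF : g F = F • b - b := by
    have h1 : (Units.map (absoluteGaloisGroup.toAlgEquiv _ F : AlgebraicClosure (v.adicCompletion K)
        →* AlgebraicClosure (v.adicCompletion K)) β) ^ (-1 : ℤ) * β⁻¹ = μ * Q ^ (-s) := by
      rw [zpow_neg, zpow_one, ← mul_inv_rev, eq_mul_inv_of_mul_eq hβ, mul_inv_rev, inv_inv,
        zpow_neg]
    rw [hb, hequiv F β, hεF, ← map_sub, sub_eq_add_neg, ← ofMul_inv, ← ofMul_mul, h1, ofMul_mul,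
      map_add, hΦQ, add_zero, hxμ]
  -- `U = {σ : g σ = σ b − b}`: an open subgroup containing `F` and `I`, hence everything
  let U : Subgroup (absoluteGaloisGroup (v.adicCompletion K)) :=
    { carrier := {σ | g σ = σ • b - b}
      one_mem' := by
        change g 1 = (1 : absoluteGaloisGroup (v.adicCompletion K)) • b - b
        rw [hg_one, one_smul, sub_self]
      mul_mem' := fun {σ τ} hσ hτ ↦ by
        change g (σ * τ) = (σ * τ) • b - b
        change g σ = σ • b - b at hσ
        change g τ = τ • b - b at hτ
        rw [hg, hσ, hτ, mul_smul, smul_sub]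
        abel
      inv_mem' := fun {σ} hσ ↦ by
        change g σ⁻¹ = σ⁻¹ • b - b
        change g σ = σ • b - b at hσ
        rw [hg_inv, hσ, smul_sub, ← mul_smul, inv_mul_cancel, one_smul]
        abel }
  have hUmem : ∀ σ, σ ∈ U ↔ g σ = σ • b - b := fun σ ↦ Iff.rfl
  have hUopen : IsOpen (U : Set (absoluteGaloisGroup (v.adicCompletion K))) := by
    apply U.isOpen_of_mem_nhds (g := 1)
    have h2 : ((MulAction.stabilizer (absoluteGaloisGroup (v.adicCompletion K)) b : Subgroup _) :
        Set (absoluteGaloisGroup (v.adicCompletion K))) ∈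
          𝓝 (1 : absoluteGaloisGroup (v.adicCompletion K)) :=
      (W.isOpen_stabilizer_localPoints (v.adicCompletion K) b).mem_nhds (one_mem _)
    refine Filter.mem_of_superset (Filter.inter_mem hg1 h2) fun σ hσ ↦ ?_
    simp only [Set.mem_inter_iff, Set.mem_setOf_eq, SetLike.mem_coe,
      MulAction.mem_stabilizer_iff] at hσ
    change g σ = σ • b - b
    rw [hσ.1, hσ.2, sub_self]
  have hFU : F ∈ U := (hUmem F).mpr hbF
  have hIU : 𝔐.inertia (absoluteGaloisGroup (v.adicCompletion K)) ≤ U := fun τ hτ ↦ by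
    rw [hUmem, hgI τ hτ, hbI τ hτ, sub_self]
  have hUtop : U = ⊤ := v.eq_top_of_isOpen_of_frobenius_mem_of_inertia_le h𝔐 hF hUopen hFU hIU
  refine ⟨b, fun σ ↦ (hUmem σ).mp ?_⟩
  rw [hUtop]
  exact Subgroup.mem_top σ

end Summit.BirchSwinnertonDyer.Rank1Residual.X11a.SelmerCompanion

end
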